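import Summits.Ventures.HSemireg.Pad4TowerSeedB1Odd

/-!
# `Cruxes/BlochSeedDiscOne/B1OddSpanControl.lean` v6 — POINTER STUB (lens «control», plan-lens-HodgeAV-control g0 ∕ g2, 2026-08-28)

HONEST FRAMING: this workfile (v1–v5, last v5 651a2b039531c043, 804 lines, 0 `sorry`) held the lens Sketch of the crux idea
`Cruxes/BlochSeedDiscOne/Ideas/b1odd-span-control.md` (v1.2): the h-uniform family `(T_h) = SeedB1OddDiamondG1H1 h`, the light-cone
BOOST, the FIRST LEMMA `StaticH1BoostInvariant` and its proof (K1), SPAN CONTROL, the realisable-diagonal-unit law (DUL-h), threshold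
extremality and the inter-height law.  On director-hodge R16.6 (1) («K1 needs no prover; its landing = an HSemireg support file») and
the critic of record's ruling L1 (idea-crit-6 g3, PASS-WITH-PRICE R14.37, P2′) the CONTENT HAS BEEN LANDED in the library and is
removed here so that no two modules of the tree declare the same names (R16.6 (1)(ii) dedup; director R16.28 (3) «ONE = control g2»):

* `Summits/Ventures/HSemireg/Pad4TowerB1OddSpanControl.lean` (landing part 1∕2; p659231 ACCEPTED 2026-08-28T18:58Z, tree 59e945da4a79f9c6) = Sketch §1 (family, antitone, cone statement,
  `SeedB1OddConeIff`), §2 (boost `boostPt` ∕ `MCell.boost` ∕ `MConfig.boostImage`, `StaticH1BoostInvariant`, `FloorAnchored`,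
  `SeedB1OddAnchored`, `SpanControl`), §3 (`diagUnit`, `DiagUnitRealisable`, `DiagUnitRealisableBoost`, (DUL-h)
  `SeedFCDiagonalDiamondG1H1`, `seedB1Odd_of_diagonal`), §6 (glue PROVED: `g1Closed_boost_iff`, `hasOddFC_boost_iff`, `spanControl`,
  `seedB1OddConeIff`, `diagUnitRealisableBoost`, `diagUnits_next_height`);
* `Summits/Ventures/HSemireg/Pad4TowerB1OddBoostBlind.lean` (landing part 2∕2, chained on part 1; p663032 ACCEPTED 2026-08-28T19:58Z, tree cf4cd721582f78a8 — K1 DISCHARGED in the tree) = Sketch §7 (K1 PROVED: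
  `staticH1BoostCore_holds`, `staticH1BoostInvariant_holds`, `seedB1OddAnchored_iff`, `diagUnitRealisable_step`,
  `diagUnits_next_height_holds`), §8 (`threshold_support_spans`, `threshold_support_spans_eight`), §9 (`CellRealisable`,
  `cellRealisable_mono`, `cellRealisable_boost`, `cellRealisable_translate`).

Both parts are in the tree; the lens
Sketch continues at HOME `run/shared/lean/pub/ideators/plan-lens-HodgeAV-control/Sketch.lean` (v8 eeee70ef677dc6ce = v5 651a2b039531c043
§1–§9 byte-unchanged + §10 THE WINDOW LAW: `inDiamond_iff_window`, `cellRealisable_window_mp`, hypothesis-form `RealisableWindowLaw`,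
`window_gap_persists`, `diagUnit_four_never`; §11 TOWER RIGIDITY `InPlaceRigidity` ∕ `UpClosure` with `windowLaw_of_inPlaceRigidity`, `inPlaceRigidity_of_windowLaw` PROVED; §12 `BoostRigidity` ∕ `NoTallFC` ∕ `RealFCClassified` with `seedB1Odd_all_of_rigidity : IR → BR → NT → CL_8 → ∀ n, T_{8+2n}` PROVED; pre-registrations F2 `pred/D10-survivors-lowerbound.txt` 6648ccaea2744931 and F2′ v2 `pred/D10-inplace-deaths-predicted.v2.txt` 8de21bd41e6d5b78 against j313137; F1 = g53 MATCH 48∕48 + 13∕13 on the ◇₆∕◇₈ pair, j309860).  The kernel probes of falsifier F3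
(Sketch §4–§5: the tree's RULE-D ∕ X⁺ ∕ A2I⁻ ∕ seed probes keep their verdicts under the boost `α ↦ α + 2`, `+ 4`) return here as v7,
importing the landed module, once the library build serves it.

Nothing here (or in the landed files) decides the typed target of record `(T_8) = SeedB1OddDiamond8G1H1` (machine ×2 + third code ×1,
not a kernel theorem), and NOTHING HERE SAYS THAT HC ∕ HC_CM ∕ HC_AV ∕ H2 (`BlochSeedDiscOne`, stmt-HodgeConjecture-18881) HOLDS OR FAILS;
typed ≠ proved; width toward H2 = 0 (critic price P1).  Census rows of record cited by the landed headers: bc5-plan card birth-v4.md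
v4.21 35df5d8b718bef10 rows W16 (j305149), W17 (j309715 ∕ j309861 ∕ j310751), W18 (j310554; (W′) j312296 UNSAT ×2, R16.23), W19 (j308425),
W22 (j313137, PREREG dd6eeaf705c32404); pre-registered falsifiers F1 ∕ F2 at `…/plan-lens-HodgeAV-control/pred/` (457cd93c5f785a00,
6648ccaea2744931, 925b3382405b18be).
-/
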